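import Summits.CriticalPhenomena.Ising3DConformalLimit.Theorems.PrecisionLaplacianDirectCorrelationStableTailSlabModeExpDecayGreenTransferAux
import Summits.CriticalPhenomena.Ising3DConformalLimit.Theorems.PrecisionLaplacianDirectCorrelationStableTailPickInversion
import Literature.MeasureTheory.Moments.HausdorffMomentGeometricDecay

/-!
# Green-to-direct-correlation transfer of the mass gap, auxiliary file 2:
# the Pick inversion lever WITH SUPPORT

Helper file for the sub-stub `stub_slabModeExpDecay_auxGreenTransfer` (brick of
`stub_slabModeExpDecay`) of line `self-energy-pick-inversion`, crux
`PrecisionLaplacian.DirectCorrelationStableTail` (stmt-CriticalPhenomena-4799). Pure theorem file.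

**Theorem** (`hausdorff_support_of_inv_hasSum_cos`, registered sub-goal
`stub_slabModeExpDecay_auxGreenTransfer3`). In the setting of the lever `hausdorff_of_inv_hasSum_cos`
(file `…PickInversionAux8`: `g` continuous, even, `2π`-periodic, positive, with cosine moments
`∫ g(θ) cos(nθ) dθ = ∫ tⁿ dμ`, `μ` finite on `[0, 1]`, and `1/g(θ) = ∑ cₘ cos(mθ)`, `∑ |cₘ| < ∞`), suppose
moreover that `μ` is carried by `[0, θ₀]` with `0 < θ₀ < 1`. Then the shifted Hausdorff moment sequence
`(-cₙ/2)_{n ≥ 1}` satisfies the ratio bound `-c_{n+1} ≤ θ₀ (-cₙ)`, so that its (unique) representing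
measure `τ` on `[0, 1]` is carried by `[0, θ₀]` as well: THE TRANSFER OF THE MASS GAP IS LOSSLESS.

Proof. With `s₀ = (θ₀ + θ₀⁻¹)/2 > 1`, the Poisson transform `F` of `μ` is holomorphic and zero-free on
`{Im z > 0} ∪ {Re z < s₀}` and real below `s₀` (file 1), so the Nevanlinna measure `ρ` of the Pick
function `-1/F` does not charge `(-∞, s₀)` (weak Stieltjes inversion below `s₀`, file 1). Reading the
cosine coefficients of `1/g` off the representation as in the lever gives
`-cₙ/2 = πβ δ_{n1} + 2∫ λ(s)ⁿ/√(s² - 1) dρ(s)` with `λ(s) = s - √(s² - 1) ≤ λ(s₀) = θ₀` for `ρ`-a.e. `s`,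
whence the ratio bound; rigidity of Hausdorff moment sequences
(`Literature.MeasureTheory.Moments.measure_Ioi_eq_zero_of_hausdorffSeq_succ_le_mul`) gives the support.
References: Akhiezer, *The classical moment problem*, Ch. 3; Donoghue (1974), Ch. II.
-/

noncomputable section

namespace Summit.CriticalPhenomena.Ising3DConformalLimit.Cruxes.DirectCorrelationStableTail.SelfEnergyPickInversion

open MeasureTheory Filter Topology Set Real Complex Metric
open scoped BigOperators ComplexConjugate
open Literature.Analysis.Complex
open Literature.MeasureTheory.Moments
open Literature.Probability.LatticeModels (Site phase)
open Summit.CriticalPhenomena.Ising3DConformalLimit.Theorems.EtaBoundsTransfer (continuous_fourier_q)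

/-! ### `λ(s) = s - √(s² - 1) ≤ θ₀` beyond `s₀ = (θ₀ + θ₀⁻¹)/2` -/

/-- For `0 < θ₀ ≤ 1` and `s ≥ s₀ = (θ₀ + θ₀⁻¹)/2`: `λ(s) = s - √(s² - 1) ≤ θ₀` (the map `λ` is the
inverse of `t ↦ (t + t⁻¹)/2` on `(0, 1]` and is decreasing). [folklore] -/
theorem cheb_lambda_le_of_le {θ₀ s : ℝ} (hθ₀ : 0 < θ₀) (hθ₁ : θ₀ ≤ 1) (hs : (θ₀ + θ₀⁻¹) / 2 ≤ s) :
    s - Real.sqrt (s ^ 2 - 1) ≤ θ₀ := by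
  have h1 : 2 * θ₀ * ((θ₀ + θ₀⁻¹) / 2) = θ₀ ^ 2 + 1 := by field_simp
  have h2 : θ₀ ^ 2 + 1 ≤ 2 * θ₀ * s := by
    have := mul_le_mul_of_nonneg_left hs (by positivity : (0 : ℝ) ≤ 2 * θ₀); linarith
  have hθs : θ₀ ≤ s := by
    by_contra hlt
    push Not at hlt
    have := mul_lt_mul_of_pos_left hlt (by positivity : (0 : ℝ) < 2 * θ₀)
    nlinarith [mul_le_mul_of_nonneg_left hθ₁ hθ₀.le]
  have h3 : s - θ₀ ≤ Real.sqrt (s ^ 2 - 1) := by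
    rw [Real.le_sqrt (by linarith) (by nlinarith)]
    nlinarith
  linarith

/-! ### The cosine coefficients of `1/g` read off a Nevanlinna representation of `-1/F` -/

/-- **The cosine coefficients of `1/g`.** In the setting of the lever (`g` continuous, even,
`2π`-periodic, positive, cosine moments of `g` = moments of the finite measure `μ` on `[0, 1]`,
`1/g(θ) = ∑ cₘ cos(mθ)` with `∑ |cₘ| < ∞`), ANY Nevanlinna data `(b, β, ρ)` representing `-1/F` on
`(-∞, 1)` — `F(x) = ∫ (1 - t²)/(1 - 2tx + t²) dμ(t)`, `ρ` σ-finite with `ρ`-a.e. `s > 1` and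
`∫ dρ/(s(s - 1)) < ∞` — satisfy `-cₙ/2 = πβ [n = 1] + 2 ∫ λ(s)ⁿ/√(s² - 1) dρ(s)` for `n ≥ 1`,
`λ(s) = s - √(s² - 1)`. [folklore] -/
theorem neg_half_coeff_eq_of_nevanlinna_repr {g : ℝ → ℝ} (hg : Continuous g)
    (hper : Function.Periodic g (2 * π)) (heven : ∀ θ, g (-θ) = g θ) (hpos : ∀ θ, 0 < g θ)
    {μ : Measure ℝ} [IsFiniteMeasure μ] (hμ : μ (Set.Icc (0 : ℝ) 1)ᶜ = 0)
    (hmom : ∀ n : ℕ, ∫ θ in (-π)..π, g θ * Real.cos (n * θ) = ∫ t, t ^ n ∂μ)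
    {c : ℕ → ℝ} (hc : Summable c) (hsum : ∀ θ, HasSum (fun m : ℕ => c m * Real.cos (m * θ)) (g θ)⁻¹)
    {b β : ℝ} {ρ : Measure ℝ} [SigmaFinite ρ] (hae' : ∀ᵐ s ∂ρ, 1 < s)
    (hu : Integrable (fun s : ℝ => (s * (s - 1))⁻¹) ρ)
    (hrep : ∀ x : ℝ, x < 1 → -(∫ t, (1 - t ^ 2) / (1 - 2 * t * x + t ^ 2) ∂μ)⁻¹ =
      b + β * x + π⁻¹ * ∫ s, ((s - x)⁻¹ - s / (1 + s ^ 2)) ∂ρ) {n : ℕ} (hn : 1 ≤ n) :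
    -(c n) / 2 = π * β * (if n = 1 then 1 else 0) +
      2 * ∫ s, (s - Real.sqrt (s ^ 2 - 1)) ^ n / Real.sqrt (s ^ 2 - 1) ∂ρ := by
  -- adapted from `hausdorff_of_inv_hasSum_cos` (file `…PickInversionAux8`), Steps 1, 4, 5, 6
  have hπ := Real.pi_pos
  have hrepr : ∀ θ : ℝ, Real.cos θ ≠ 1 →
      2 * π * g θ = ∫ t, (1 - t ^ 2) / (1 - 2 * t * Real.cos θ + t ^ 2) ∂μ :=
    fun θ hθ => two_pi_mul_eq_integral_poisson hg hper heven hμ hmom hθ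
  -- the pointwise identity for `1/g`
  have hkey : ∀ θ : ℝ, Real.cos θ ≠ 1 → (g θ)⁻¹ = -(2 * π * b) * Real.cos ((0 : ℕ) * θ) +
      -(2 * π * β) * (Real.cos ((1 : ℕ) * θ) * 1) +
      -2 * ∫ s, ((s - Real.cos θ)⁻¹ - s / (1 + s ^ 2)) ∂ρ := by
    intro θ hθ
    have hlt : Real.cos θ < 1 := lt_of_le_of_ne (Real.cos_le_one θ) hθ
    have h1 := hrepr θ hθ
    have h2 := hrep (Real.cos θ) hlt
    have hgθ := hpos θ
    have hF : (∫ t, (1 - t ^ 2) / (1 - 2 * t * Real.cos θ + t ^ 2) ∂μ) = 2 * π * g θ := h1.symm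
    rw [hF] at h2
    simp only [Nat.cast_zero, zero_mul, Real.cos_zero, mul_one, Nat.cast_one, one_mul]
    have : (g θ)⁻¹ = -(2 * π) * (-(2 * π * g θ)⁻¹) := by field_simp
    rw [this, h2]
    field_simp
    ring
  -- the cosine coefficients, two ways
  have hcoef : π * c n = -(2 * π * β) * (if 1 = n then π else 0) +
      -2 * ∫ s, 2 * π * (s - Real.sqrt (s ^ 2 - 1)) ^ n / Real.sqrt (s ^ 2 - 1) ∂ρ := by
    obtain ⟨hI, hIval⟩ := integral_nevanlinna_integral_mul_cos hae' hu hn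
    rw [← integral_mul_cos_of_hasSum_cos hc hsum hn]
    have hcongr : ∫ θ in (-π)..π, (g θ)⁻¹ * Real.cos (n * θ) = ∫ θ in (-π)..π,
        (-(2 * π * b) * (Real.cos ((0 : ℕ) * θ) * Real.cos (n * θ)) +
          -(2 * π * β) * (Real.cos ((1 : ℕ) * θ) * Real.cos (n * θ)) +
          -2 * ((∫ s, ((s - Real.cos θ)⁻¹ - s / (1 + s ^ 2)) ∂ρ) * Real.cos (n * θ))) := by
      refine intervalIntegral.integral_congr_ae (ae_cos_ne_one.mono fun θ hθ hmem => ?_)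
      rw [hkey θ (hθ hmem)]
      simp only [mul_one]
      ring
    have hi0 : IntervalIntegrable (fun θ => -(2 * π * b) * (Real.cos ((0 : ℕ) * θ) * Real.cos (n * θ))) volume (-π) π :=
      Continuous.intervalIntegrable (by fun_prop) _ _
    have hi1 : IntervalIntegrable (fun θ => -(2 * π * β) * (Real.cos ((1 : ℕ) * θ) * Real.cos (n * θ))) volume (-π) π :=
      Continuous.intervalIntegrable (by fun_prop) _ _
    rw [hcongr, intervalIntegral.integral_add (hi0.add hi1) (hI.const_mul _), intervalIntegral.integral_add hi0 hi1,
      intervalIntegral.integral_const_mul, intervalIntegral.integral_const_mul, intervalIntegral.integral_const_mul,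
      hIval, integral_cos_mul_cos le_rfl hn]
    simp only [Nat.cast_zero, zero_mul, Real.cos_zero, one_mul]
    rw [integral_cos_nat_mul, if_neg (by omega)]
    ring
  -- conclusion
  have hI2 : ∫ s, 2 * π * (s - Real.sqrt (s ^ 2 - 1)) ^ n / Real.sqrt (s ^ 2 - 1) ∂ρ =
      2 * π * ∫ s, (s - Real.sqrt (s ^ 2 - 1)) ^ n / Real.sqrt (s ^ 2 - 1) ∂ρ := by
    rw [← MeasureTheory.integral_const_mul]
    exact integral_congr_ae (Eventually.of_forall fun s => by ring)
  rw [hI2] at hcoef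
  by_cases h1 : n = 1
  · subst h1
    simp only [if_true] at hcoef ⊢
    have : c 1 = -(2 * π * β) - 4 * ∫ s, (s - Real.sqrt (s ^ 2 - 1)) ^ 1 / Real.sqrt (s ^ 2 - 1) ∂ρ := by
      apply mul_left_cancel₀ hπ.ne'
      rw [hcoef]; ring
    rw [this]; ring
  · rw [if_neg (Ne.symm h1)] at hcoef
    rw [if_neg h1]
    have : c n = -4 * ∫ s, (s - Real.sqrt (s ^ 2 - 1)) ^ n / Real.sqrt (s ^ 2 - 1) ∂ρ := by
      apply mul_left_cancel₀ hπ.ne'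
      rw [hcoef]; ring
    rw [this]; ring

/-! ### The lever with support -/

/-- **Ratio bound for the inverted moment sequence** (the lever with support, sequence form). In the
setting of `hausdorff_of_inv_hasSum_cos`, if moreover `μ((θ₀, ∞)) = 0` with `0 < θ₀ < 1`, then
`-c_{n+1} ≤ θ₀ · (-cₙ)` for every `n ≥ 1`. [folklore] -/
theorem neg_coeff_succ_le_of_inv_hasSum_cos {g : ℝ → ℝ} (hg : Continuous g)
    (hper : Function.Periodic g (2 * π)) (heven : ∀ θ, g (-θ) = g θ) (hpos : ∀ θ, 0 < g θ)
    {μ : Measure ℝ} [IsFiniteMeasure μ] (hμ : μ (Set.Icc (0 : ℝ) 1)ᶜ = 0)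
    {θ₀ : ℝ} (hθ₀ : 0 < θ₀) (hθ₁ : θ₀ < 1) (hμθ : μ (Set.Ioi θ₀) = 0)
    (hmom : ∀ n : ℕ, ∫ θ in (-π)..π, g θ * Real.cos (n * θ) = ∫ t, t ^ n ∂μ)
    {c : ℕ → ℝ} (hc : Summable c) (hsum : ∀ θ, HasSum (fun m : ℕ => c m * Real.cos (m * θ)) (g θ)⁻¹)
    {n : ℕ} (hn : 1 ≤ n) : -(c (n + 1)) ≤ θ₀ * -(c n) := by
  have hπ := Real.pi_pos
  -- the measure is carried by `[0, θ₀]` and charges `[0, 1)`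
  have hμ' : μ (Set.Icc (0 : ℝ) θ₀)ᶜ = 0 := by
    refine measure_mono_null (fun t ht => ?_) (measure_union_null hμ hμθ)
    by_cases h1 : t ∈ Set.Icc (0 : ℝ) 1
    · exact Or.inr (lt_of_not_ge fun h => ht ⟨h1.1, h⟩)
    · exact Or.inl h1
  have hrepr : ∀ θ : ℝ, Real.cos θ ≠ 1 →
      2 * π * g θ = ∫ t, (1 - t ^ 2) / (1 - 2 * t * Real.cos θ + t ^ 2) ∂μ :=
    fun θ hθ => two_pi_mul_eq_integral_poisson hg hper heven hμ hmom hθ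
  have hμ0 : μ (Set.Ico (0 : ℝ) 1) ≠ 0 := by
    -- adapted from `hausdorff_of_inv_hasSum_cos`, Step 2
    intro h0
    have hae1 : ∀ᵐ t ∂μ, t = 1 := by
      rw [ae_iff]
      refine measure_mono_null (fun t ht => ?_) (measure_union_null hμ h0)
      by_cases h : t ∈ Set.Icc (0 : ℝ) 1
      · exact Or.inr ⟨h.1, lt_of_le_of_ne h.2 ht⟩
      · exact Or.inl h
    have h1 := hrepr π (by rw [Real.cos_pi]; norm_num)
    rw [integral_congr_ae (hae1.mono fun t ht => show (1 - t ^ 2) / (1 - 2 * t * Real.cos π + t ^ 2) = (0 : ℝ) by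
      rw [ht]; norm_num), integral_zero] at h1
    have := hpos π
    nlinarith
  have hμu : μ Set.univ ≠ 0 := fun h => hμ0 (measure_mono_null (Set.subset_univ _) h)
  -- the Pick function `H = -1/F` and its Nevanlinna data
  set H : ℂ → ℂ := fun z => -(∫ t, ((1 - t ^ 2 : ℝ) : ℂ) / (1 - 2 * (t : ℂ) * z + (t : ℂ) ^ 2) ∂μ)⁻¹
    with hH
  have hPick : IsPickFunction H := isPickFunction_neg_inv_poissonTransform μ hμ hμ0
  obtain ⟨b, β, ρ, hβ, hρ, hrep⟩ := (nevanlinna_representation_holds H).1 hPick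
  have hcontV : ContinuousOn H {z : ℂ | 0 < z.im ∨ z.re < (θ₀ + θ₀⁻¹) / 2} :=
    (((differentiableOn_poissonTransform_of_le μ hθ₀ hθ₁.le hμ').continuousOn.inv₀ fun z hz =>
      poissonTransform_ne_zero_of_le μ hθ₀ hθ₁ hμ' hμu hz).neg)
  have hHreal : ∀ x : ℝ, H x = ((-(∫ t, (1 - t ^ 2) / (1 - 2 * t * x + t ^ 2) ∂μ)⁻¹ : ℝ) : ℂ) := by
    intro x
    simp only [hH, poissonTransform_ofReal]
    push_cast
    rfl
  have hrealV : ∀ x : ℝ, x < (θ₀ + θ₀⁻¹) / 2 → (H x).im = 0 := fun x _ => by rw [hHreal, Complex.ofReal_im]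
  -- weak Stieltjes inversion below `s₀`: `ρ` lives on `[s₀, ∞)`
  have hρs₀ : ρ (Set.Iio ((θ₀ + θ₀⁻¹) / 2)) = 0 :=
    nevanlinna_measure_Iio_eq_zero_of_lt hcontV hrealV hβ hρ hrep
  have hs₀ : 1 < (θ₀ + θ₀⁻¹) / 2 := by
    have h1 : 2 * θ₀ * ((θ₀ + θ₀⁻¹) / 2) = θ₀ ^ 2 + 1 := by field_simp
    nlinarith [sq_nonneg (θ₀ - 1), mul_pos hθ₀ (sub_pos.2 hθ₁)]
  have hρ1 : ρ (Set.Iio 1) = 0 := measure_mono_null (Set.Iio_subset_Iio hs₀.le) hρs₀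
  -- the representation on the real half-line `(-∞, 1)`, in real form
  have hcont1 : ContinuousOn H {z : ℂ | 0 < z.im ∨ z.re < 1} :=
    hcontV.mono fun z hz => hz.imp_right fun h => lt_trans h hs₀
  have hrepR : ∀ x : ℝ, x < 1 → -(∫ t, (1 - t ^ 2) / (1 - 2 * t * x + t ^ 2) ∂μ)⁻¹ =
      b + β * x + π⁻¹ * ∫ s, ((s - x)⁻¹ - s / (1 + s ^ 2)) ∂ρ := by
    -- adapted from `exists_nevanlinna_repr_neg_inv_poissonTransform` (file `…PickInversionAux5`)
    intro x hx
    have h := nevanlinna_repr_of_real_lt_one hcont1 hρ hρ1 hrep hx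
    rw [hHreal] at h
    have hK : (fun s : ℝ => ((s : ℂ) - x)⁻¹ - (s : ℂ) / (1 + (s : ℂ) ^ 2)) =
        fun s : ℝ => (((s - x)⁻¹ - s / (1 + s ^ 2) : ℝ) : ℂ) := by
      funext s; push_cast; rfl
    have hint : ∫ s, (((s - x)⁻¹ - s / (1 + s ^ 2) : ℝ) : ℂ) ∂ρ =
        ((∫ s, ((s - x)⁻¹ - s / (1 + s ^ 2)) ∂ρ : ℝ) : ℂ) := _root_.integral_ofReal
    rw [hK, hint] at h
    have hpi : ((Real.pi : ℂ)⁻¹) = ((Real.pi⁻¹ : ℝ) : ℂ) := by push_cast; rfl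
    rw [hpi] at h
    exact_mod_cast h
  obtain ⟨hρpt, hu⟩ := integrable_inv_mul_sub_one_of_repr
    (A := fun x => -(∫ t, (1 - t ^ 2) / (1 - 2 * t * x + t ^ 2) ∂μ)⁻¹) hρ hρ1 hrepR
    (fun x _ hx1 => neg_nonpos.2 (inv_nonneg.2 (poissonTransform_real_nonneg μ hμ hx1.le)))
  have hae' : ∀ᵐ s ∂ρ, 1 < s := ae_one_lt_of_null hρ1 hρpt
  have haeS : ∀ᵐ s ∂ρ, (θ₀ + θ₀⁻¹) / 2 ≤ s := by
    rw [ae_iff]; simp only [not_le]; exact hρs₀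
  haveI : SigmaFinite ρ := sigmaFinite_of_integrable_inv hρ
  -- the coefficients and the ratio bound
  set lam : ℝ → ℝ := fun s => s - Real.sqrt (s ^ 2 - 1) with hlam
  have hI : ∀ m : ℕ, 1 ≤ m → Integrable (fun s => lam s ^ m / Real.sqrt (s ^ 2 - 1)) ρ := by
    intro m hm
    refine Integrable.mono' hu (Measurable.aestronglyMeasurable (by simp only [hlam]; fun_prop)) ?_
    filter_upwards [hae'] with s hs
    obtain ⟨h0, h1⟩ := cheb_lambda_mem hs
    have hsq : 0 < Real.sqrt (s ^ 2 - 1) := Real.sqrt_pos.2 (by nlinarith)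
    have hb := (cheb_weight_bounds hs).2.2.2
    rw [Real.norm_eq_abs, abs_of_nonneg (div_nonneg (pow_nonneg h0.le _) hsq.le)]
    calc lam s ^ m / Real.sqrt (s ^ 2 - 1) ≤ lam s ^ 1 / Real.sqrt (s ^ 2 - 1) :=
          div_le_div_of_nonneg_right (pow_le_pow_of_le_one h0.le h1.le hm) hsq.le
      _ ≤ (s * (s - 1))⁻¹ := by rw [pow_one, ← one_div]; exact hb
  have hstep : ∫ s, lam s ^ (n + 1) / Real.sqrt (s ^ 2 - 1) ∂ρ ≤
      θ₀ * ∫ s, lam s ^ n / Real.sqrt (s ^ 2 - 1) ∂ρ := by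
    rw [← MeasureTheory.integral_const_mul]
    refine integral_mono_ae (hI (n + 1) (by omega)) ((hI n hn).const_mul θ₀) ?_
    filter_upwards [hae', haeS] with s hs hsS
    obtain ⟨h0, h1⟩ := cheb_lambda_mem hs
    have hsq : 0 < Real.sqrt (s ^ 2 - 1) := Real.sqrt_pos.2 (by nlinarith)
    have hle : lam s ≤ θ₀ := cheb_lambda_le_of_le hθ₀ hθ₁.le hsS
    rw [pow_succ, mul_comm (lam s ^ n), mul_div_assoc]
    exact mul_le_mul_of_nonneg_right hle (div_nonneg (pow_nonneg h0.le _) hsq.le)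
  have hn0 := neg_half_coeff_eq_of_nevanlinna_repr hg hper heven hpos hμ hmom hc hsum hae' hu hrepR hn
  have hn1 := neg_half_coeff_eq_of_nevanlinna_repr hg hper heven hpos hμ hmom hc hsum hae' hu hrepR
    (show 1 ≤ n + 1 by omega)
  rw [if_neg (by omega : n + 1 ≠ 1)] at hn1
  have hind : 0 ≤ π * β * (if n = 1 then (1 : ℝ) else 0) := by
    split_ifs
    · positivity
    · simp
  have hIn : 0 ≤ ∫ s, lam s ^ n / Real.sqrt (s ^ 2 - 1) ∂ρ := by
    refine integral_nonneg_of_ae ?_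
    filter_upwards [hae'] with s hs
    obtain ⟨h0, _⟩ := cheb_lambda_mem hs
    exact div_nonneg (pow_nonneg h0.le _) (Real.sqrt_nonneg _)
  have h2 : -(c (n + 1)) / 2 ≤ θ₀ * (-(c n) / 2) := by
    rw [hn1, hn0]
    nlinarith [hstep, hind, hIn, hθ₀.le]
  linarith

/-- **Pick inversion with support** (THE LEVER, lossless form). In the setting of
`hausdorff_of_inv_hasSum_cos`, if moreover `μ((θ₀, ∞)) = 0` with `0 < θ₀ < 1`, then the representing
measure `τ` of `(-cₙ/2)_{n ≥ 1}` can be taken carried by `[0, θ₀]`: there is a finite positive measure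
`τ` on `[0, 1]` with `τ((θ₀, ∞)) = 0` and `-cₙ/2 = ∫ t^{n-1} dτ` for all `n ≥ 1`. [folklore] -/
theorem hausdorff_support_of_inv_hasSum_cos {g : ℝ → ℝ} (hg : Continuous g)
    (hper : Function.Periodic g (2 * π)) (heven : ∀ θ, g (-θ) = g θ) (hpos : ∀ θ, 0 < g θ)
    {μ : Measure ℝ} [IsFiniteMeasure μ] (hμ : μ (Set.Icc (0 : ℝ) 1)ᶜ = 0)
    {θ₀ : ℝ} (hθ₀ : 0 < θ₀) (hθ₁ : θ₀ < 1) (hμθ : μ (Set.Ioi θ₀) = 0)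
    (hmom : ∀ n : ℕ, ∫ θ in (-π)..π, g θ * Real.cos (n * θ) = ∫ t, t ^ n ∂μ)
    {c : ℕ → ℝ} (hc : Summable c) (hsum : ∀ θ, HasSum (fun m : ℕ => c m * Real.cos (m * θ)) (g θ)⁻¹) :
    ∃ τ : Measure ℝ, IsFiniteMeasure τ ∧ τ (Set.Icc (0 : ℝ) 1)ᶜ = 0 ∧ τ (Set.Ioi θ₀) = 0 ∧
      ∀ n : ℕ, 1 ≤ n → -(c n) / 2 = ∫ t, t ^ (n - 1) ∂τ := by
  obtain ⟨τ, hτfin, hτsupp, hτmom⟩ := hausdorff_of_inv_hasSum_cos hg hper heven hpos hμ hmom hc hsum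
  haveI := hτfin
  refine ⟨τ, hτfin, hτsupp, ?_, hτmom⟩
  refine measure_Ioi_eq_zero_of_hausdorffSeq_succ_le_mul (fun n => -(c n) / 2) τ hτsupp hτmom θ₀ hθ₀.le
    fun n hn => ?_
  have h := neg_coeff_succ_le_of_inv_hasSum_cos hg hper heven hpos hμ hθ₀ hθ₁ hμθ hmom hc hsum hn
  show -(c (n + 1)) / 2 ≤ θ₀ * (-(c n) / 2)
  linarith

/-! ### Pick inversion of the slab modes at a good transverse momentum, with support -/

/-- **Pick inversion of the slab modes at a good transverse momentum, with support.** In the setting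
of `hausdorff_slabModes_of_good` (file `…PickInversion`: `q ≥ 0` summable, reflection symmetric in the
`i`-th coordinate, `φ(ins_i(θ, k₀)) < 1`, cosine moments of `1/(1 - φ(ins_i(·, k₀)))` = moments of the
finite measure `μ` on `[0, 1]`), if moreover `μ((θ₀, ∞)) = 0` with `0 < θ₀ < 1`, then the slab modes
`αₙ = ∑_y q(ins_i(n, y)) cos(k₀·y)` are `∫ t^{n-1} dτ` (`n ≥ 1`) for a finite positive measure `τ` on
`[0, 1]` CARRIED BY `[0, θ₀]`. [folklore] -/
theorem hausdorff_support_slabModes_of_good {q : Site 3 → ℝ} (hq0 : ∀ y, 0 ≤ q y) (hqs : Summable q)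
    (i : Fin 3) (hqrefl : ∀ y : Site 3, q (Function.update y i (-y i)) = q y) (k₀ : Fin 2 → ℝ)
    (hgood : ∀ θ : ℝ, ∑' x : Site 3, q x * Real.cos (phase 3 (Fin.insertNth i θ k₀ : Fin 3 → ℝ) x) < 1)
    {μ : Measure ℝ} [IsFiniteMeasure μ] (hμ : μ (Set.Icc (0 : ℝ) 1)ᶜ = 0)
    {θ₀ : ℝ} (hθ₀ : 0 < θ₀) (hθ₁ : θ₀ < 1) (hμθ : μ (Set.Ioi θ₀) = 0)
    (hmom : ∀ n : ℕ, ∫ θ in (-π)..π, Real.cos (n * θ) /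
      (1 - ∑' x : Site 3, q x * Real.cos (phase 3 (Fin.insertNth i θ k₀ : Fin 3 → ℝ) x)) = ∫ t, t ^ n ∂μ) :
    ∃ τ : Measure ℝ, IsFiniteMeasure τ ∧ τ (Set.Icc (0 : ℝ) 1)ᶜ = 0 ∧ τ (Set.Ioi θ₀) = 0 ∧ ∀ n : ℕ, 1 ≤ n →
      ∑' y : Fin 2 → ℤ, q (Fin.insertNth i (n : ℤ) y) * Real.cos (phase 2 k₀ y) = ∫ t, t ^ (n - 1) ∂τ := by
  -- adapted from `hausdorff_slabModes_of_good` (file `…PickInversion`): same dictionary, lever with support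
  have hπ := Real.pi_pos
  set φθ : ℝ → ℝ := fun θ => ∑' x : Site 3, q x * Real.cos (phase 3 (Fin.insertNth i θ k₀ : Fin 3 → ℝ) x) with hφθ
  have hφcont : Continuous φθ := (continuous_fourier_q hqs).comp (continuous_insertNth_left i k₀)
  set g : ℝ → ℝ := fun θ => (1 - φθ θ)⁻¹ with hg
  have hden : ∀ θ, 0 < 1 - φθ θ := fun θ => by have := hgood θ; simp only [hφθ]; linarith
  have hgcont : Continuous g := Continuous.inv₀ (by fun_prop) fun θ => (hden θ).ne'
  have hgpos : ∀ θ, 0 < g θ := fun θ => inv_pos.2 (hden θ)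
  -- periodicity
  have hφper : Function.Periodic φθ (2 * π) := by
    intro θ
    simp only [hφθ]
    refine tsum_congr fun x => ?_
    rw [phase_insertNth, phase_insertNth, show (θ + 2 * π) * (x i : ℝ) + phase 2 k₀ (fun j => x (i.succAbove j)) =
      θ * (x i : ℝ) + phase 2 k₀ (fun j => x (i.succAbove j)) + (x i : ℤ) * (2 * π) by ring,
      Real.cos_add_int_mul_two_pi]
  have hgper : Function.Periodic g (2 * π) := fun θ => by simp only [hg, hφper θ]
  -- evenness (reflection of the `i`-th coordinate)
  have hinv : Function.Involutive fun x : Site 3 => Function.update x i (-x i) := by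
    intro x; ext j
    by_cases hj : j = i
    · subst hj; simp
    · simp [Function.update_of_ne hj]
  set R : Site 3 ≃ Site 3 := hinv.toPerm _ with hR
  have hφeven : ∀ θ, φθ (-θ) = φθ θ := by
    intro θ
    simp only [hφθ]
    rw [← R.tsum_eq (fun x : Site 3 => q x * Real.cos (phase 3 (Fin.insertNth i θ k₀ : Fin 3 → ℝ) x))]
    refine tsum_congr fun x => ?_
    have hRx : R x = Function.update x i (-x i) := rfl
    rw [hRx, hqrefl, phase_insertNth, phase_insertNth]
    congr 2
    simp only [Function.update_self, Int.cast_neg]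
    have : (fun j => Function.update x i (-x i) (i.succAbove j)) = fun j => x (i.succAbove j) := by
      funext j; rw [Function.update_of_ne (Fin.succAbove_ne i j)]
    rw [this]; ring
  have hgeven : ∀ θ, g (-θ) = g θ := fun θ => by simp only [hg, hφeven θ]
  -- the moments of `g`
  have hmom' : ∀ n : ℕ, ∫ θ in (-π)..π, g θ * Real.cos (n * θ) = ∫ t, t ^ n ∂μ := by
    intro n
    rw [← hmom n]
    refine intervalIntegral.integral_congr fun θ _ => ?_
    simp only [hg]; rw [div_eq_mul_inv, mul_comm]
  -- the cosine series of `1/g = 1 - φ`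
  obtain ⟨hαsum, hser⟩ := hasSum_symbol_slab hq0 hqs i hqrefl k₀
  set α : ℕ → ℝ := fun n => ∑' y : Fin 2 → ℤ, q (Fin.insertNth i (n : ℤ) y) * Real.cos (phase 2 k₀ y) with hα
  set c : ℕ → ℝ := fun n => if n = 0 then 1 - α 0 else -2 * α n with hc
  have hcsum : Summable c := by
    refine Summable.of_norm_bounded ((hαsum.abs.mul_left 2).add (hasSum_ite_eq 0 |1 - α 0|).summable) fun n => ?_
    rw [Real.norm_eq_abs, hc]
    by_cases hn : n = 0
    · subst hn; simp
    · simp only [if_neg hn, abs_mul, abs_neg, abs_two, add_zero]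
      exact le_rfl
  have hsum : ∀ θ, HasSum (fun m : ℕ => c m * Real.cos (m * θ)) (g θ)⁻¹ := by
    intro θ
    have h := hser θ
    simp only [hg, inv_inv]
    refine h.congr_fun fun m => ?_
    by_cases hm : m = 0
    · subst hm; simp [hc, hα]
    · simp only [hc, hα, if_neg hm]
  obtain ⟨τ, hτfin, hτsupp, hτθ, hτmom⟩ :=
    hausdorff_support_of_inv_hasSum_cos hgcont hgper hgeven hgpos hμ hθ₀ hθ₁ hμθ hmom' hcsum hsum
  refine ⟨τ, hτfin, hτsupp, hτθ, fun n hn => ?_⟩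
  rw [← hτmom n hn]
  simp only [hc, if_neg (by omega : n ≠ 0), hα]
  ring

/-- **Registered auxiliary stub `stub_slabModeExpDecay_auxGreenTransfer3`** (sub-goal of the brick
`stub_slabModeExpDecay_auxGreenTransfer` of `stub_slabModeExpDecay`): the lever with support
(`hausdorff_support_of_inv_hasSum_cos`) — for `g` continuous, even, `2π`-periodic and positive whose
cosine moments are the moments of a finite measure `μ` on `[0, 1]` CARRIED BY `[0, θ₀]` (`0 < θ₀ < 1`), and
`1/g = ∑ cₘ cos(m·)` with `∑ |cₘ| < ∞`, the shifted Hausdorff moment sequence `(-cₙ/2)_{n≥1}` is represented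
by a finite measure on `[0, 1]` carried by `[0, θ₀]`. [folklore] -/
theorem stub_slabModeExpDecay_auxGreenTransfer3 : ∀ (g : ℝ → ℝ) (μ : MeasureTheory.Measure ℝ) (θ₀ : ℝ)
    (c : ℕ → ℝ), Continuous g → Function.Periodic g (2 * Real.pi) → (∀ θ : ℝ, g (-θ) = g θ) →
    (∀ θ : ℝ, 0 < g θ) → MeasureTheory.IsFiniteMeasure μ → μ (Set.Icc (0 : ℝ) 1)ᶜ = 0 → 0 < θ₀ → θ₀ < 1 →
    μ (Set.Ioi θ₀) = 0 → (∀ n : ℕ, ∫ θ in (-Real.pi)..Real.pi, g θ * Real.cos (n * θ) = ∫ t, t ^ n ∂μ) →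
    Summable c → (∀ θ : ℝ, HasSum (fun m : ℕ => c m * Real.cos (m * θ)) (g θ)⁻¹) →
    ∃ τ : MeasureTheory.Measure ℝ, MeasureTheory.IsFiniteMeasure τ ∧ τ (Set.Icc (0 : ℝ) 1)ᶜ = 0 ∧
      τ (Set.Ioi θ₀) = 0 ∧ ∀ n : ℕ, 1 ≤ n → -(c n) / 2 = ∫ t, t ^ (n - 1) ∂τ :=
  fun _ _ _ _ hg hper heven hpos hfin hμ hθ₀ hθ₁ hμθ hmom hc hsum => by
    haveI := hfin
    exact hausdorff_support_of_inv_hasSum_cos hg hper heven hpos hμ hθ₀ hθ₁ hμθ hmom hc hsum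

end Summit.CriticalPhenomena.Ising3DConformalLimit.Cruxes.DirectCorrelationStableTail.SelfEnergyPickInversion

end
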